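import Summits.KontsevichZagierPeriods.KontsevichZagierPeriods.Theorems.ComplexOrientationsCauchyMoveAlgGraphClosure

/-!
# Route `ComplexOrientations`, support item `CauchyMove` (stmt-KontsevichZagierPeriods-11370):
# algebraic holomorphic germs are `ℚ`-semialgebraic — part 3 (the derivative; packaging)

Helper file (prover-owned, `--supports CauchyMove`), continuing
`ComplexOrientationsCauchyMoveAlgGraphClosure.lean`.

* `isSemialgebraic_graph_deriv`: the graph of `g'` over the disc is `ℚ`-semialgebraic — off the
  ramification locus it is the image of the graph of `g` under the `ℚ`-semialgebraic map
  `(w, t) ↦ (-P_t/P_w (w, t), t)` (implicit differentiation), and the closure trick of part 2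
  extends this over the zeros of `∂P/∂w (g t, t)`.
* `re_im_algHolo`, `re_im_algHolo_deriv` (**Theorem A** of the Cauchy move): the real and
  imaginary parts of `x ↦ g (x₀ + i x₁)` and of `x ↦ g' (x₀ + i x₁)` are `ℚ`-semialgebraic
  functions (`IsSemialgebraicFunOn ℚ`) on every `ℚ`-semialgebraic subset of the disc in `ℝ²` —
  the form consumed by the Kontsevich–Zagier calculus (`KZ.IntegralRep`, `KZ.newtonLeibnizRel`).

Sources: Bochnak–Coste–Roy (1998), §2.2 and Prop. 2.9.1; Kontsevich–Zagier, *Periods* (2001),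
§1.1 ("algebraic functions with algebraic coefficients are allowed"). Fully proved ([folklore]).
-/

noncomputable section

open MvPolynomial Set Metric
open Literature.ModelTheory.ExponentialFields Literature.NumberTheory.Transcendental

namespace Summit.KontsevichZagierPeriods.ComplexOrientations.CauchyMoveAux

/-- The argument coordinate `t = z₀ + i z₁` of `z ∈ ℝ⁴ ≅ ℂ²` (local notation). -/
local notation:max "cxT " z:max => (Complex.mk (z 0) (z 1))

/-- The value coordinate `w = z₂ + i z₃` of `z ∈ ℝ⁴ ≅ ℂ²` (local notation). -/
local notation:max "cxW " z:max => (Complex.mk (z 2) (z 3))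

/-- The complex point `(w, t) = (z₂ + i z₃, z₀ + i z₁) ∈ ℂ²` attached to `z ∈ ℝ⁴`: first the
"value" coordinate `w`, then the "argument" coordinate `t` (local notation). -/
local notation:max "rho4 " z:max => (![Complex.mk (z 2) (z 3), Complex.mk (z 0) (z 1)] : Fin 2 → ℂ)

/-- The complex number `x₀ + i x₁` attached to a point `x ∈ ℝ²` (local notation). -/
local notation:max "cx " x:max => (Complex.mk (x 0) (x 1))

section Deriv

open Filter Topology

variable {R₁ : ℚ} {g : ℂ → ℂ} {P : MvPolynomial (Fin 2) ℚ}

/-- **The graph of the derivative is semialgebraic**: over the good locus it is the image of the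
graph of `g` under the semialgebraic map `(w, t) ↦ (-P_t/P_w (w, t), t)`, and the closure trick
extends this over the whole disc. -/
theorem isSemialgebraic_graph_deriv (hR : 0 < R₁) (hg : DifferentiableOn ℂ g (ball 0 R₁))
    (hP : ∃ P : MvPolynomial (Fin 2) ℚ, P ≠ 0 ∧ ∀ t ∈ ball (0 : ℂ) R₁, aeval ![g t, t] P = 0) :
    IsSemialgebraic ℚ {z : Fin 4 → ℝ | cxT z ∈ ball (0 : ℂ) R₁ ∧ cxW z = deriv g (cxT z)} := by
  obtain ⟨P, hPU, hgood⟩ := exists_goodPoly isOpen_ball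
    ⟨0, mem_ball_self (by exact_mod_cast hR)⟩ g hP
  set S : Set ℂ := {t | t ∈ ball (0 : ℂ) R₁ ∧ aeval ![g t, t] (pderiv 0 P) ≠ 0} with hS
  set Γ' : Set (Fin 4 → ℝ) := {z | cxT z ∈ S ∧ cxW z = g (cxT z)} with hΓ'
  have hΓ's : IsSemialgebraic ℚ Γ' := isSemialgebraic_graph_off hR hg hPU
  set T : Set (Fin 4 → ℝ) := {z | aeval (rho4 z) (pderiv 0 P) ≠ 0} with hT
  have hTs : IsSemialgebraic ℚ T := isSemialgebraic_setOf_aeval_rho4_ne_zero _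
  have hrho : ∀ z : Fin 4 → ℝ, cxW z = g (cxT z) → rho4 z = ![g (cxT z), cxT z] := fun z hz => by
    rw [hz]
  have hΓ'T : Γ' ⊆ T := by
    rintro z ⟨⟨-, hzf⟩, hzw⟩
    show aeval (rho4 z) (pderiv 0 P) ≠ 0
    rwa [hrho z hzw]
  -- the semialgebraic map `Ψ`
  set q : (Fin 4 → ℝ) → ℂ := fun z =>
    -aeval (rho4 z) (pderiv 1 P) / aeval (rho4 z) (pderiv 0 P) with hq
  have hqs : IsSemialgebraicFunOn ℚ T (fun z => (q z).re) ∧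
      IsSemialgebraicFunOn ℚ T (fun z => (q z).im) :=
    re_im_div (re_im_neg (re_im_aeval_rho4 hTs _)) (re_im_aeval_rho4 hTs _) fun z hz => hz
  set Ψ : (Fin 4 → ℝ) → (Fin 4 → ℝ) := fun z => ![z 0, z 1, (q z).re, (q z).im] with hΨ
  have hΨs : IsSemialgebraicMapOn ℚ T Ψ := by
    refine IsSemialgebraicMapOn.of_forall hTs fun j => ?_
    fin_cases j
    · simpa [hΨ] using isSemialgebraicFunOn_aeval hTs (X 0)
    · simpa [hΨ] using isSemialgebraicFunOn_aeval hTs (X 1)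
    · simpa [hΨ] using hqs.1
    · simpa [hΨ] using hqs.2
  have himg : IsSemialgebraic ℚ (Ψ '' Γ') :=
    IsSemialgebraicMapOn.isSemialgebraic_image_holds hΨs hΓ'T hΓ's
  -- `Ψ '' Γ'` is the graph of `g'` over `S`
  have hq_eq : ∀ z ∈ Γ', q z = deriv g (cxT z) := by
    rintro z ⟨⟨hzb, hzf⟩, hzw⟩
    rw [hq]
    simp only [hrho z hzw]
    exact (deriv_eq_neg_div hg hPU hzb hzf).symm
  have heq : Ψ '' Γ' = {z : Fin 4 → ℝ | cxT z ∈ S ∧ cxW z = deriv g (cxT z)} := by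
    apply Subset.antisymm
    · rintro _ ⟨z, hz, rfl⟩
      have h1 : cxT (Ψ z) = cxT z := Complex.ext rfl rfl
      refine ⟨by rw [h1]; exact hz.1, ?_⟩
      rw [h1, ← hq_eq z hz]
      exact Complex.ext rfl rfl
    · rintro y ⟨hyS, hyw⟩
      set z : Fin 4 → ℝ := ![y 0, y 1, (g (cxT y)).re, (g (cxT y)).im] with hz
      have hzT : cxT z = cxT y := Complex.ext rfl rfl
      have hzW : cxW z = g (cxT y) := Complex.ext rfl rfl
      have hzΓ : z ∈ Γ' := ⟨by rw [hzT]; exact hyS, by rw [hzW, hzT]⟩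
      refine ⟨z, hzΓ, ?_⟩
      have hqz : q z = cxW y := by rw [hq_eq z hzΓ, hzT, hyw]
      ext i
      fin_cases i
      · rfl
      · rfl
      · show (q z).re = y 2
        rw [hqz]
      · show (q z).im = y 3
        rw [hqz]
  rw [heq] at himg
  have hd : ContinuousOn (deriv g) (ball (0 : ℂ) R₁) :=
    ((hg.analyticOnNhd isOpen_ball).deriv).continuousOn
  rw [graph_eq_closure_inter isOpen_ball hd (fun t ht => ht.1) (dense_good hg hgood)]
  exact (isSemialgebraic_closure himg).inter (isSemialgebraic_setOf_cxT_mem_ball hR)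

end Deriv

/-! ### Packaging: real and imaginary parts on plane domains -/

section Packaging

/-- From the graph in `ℝ⁴` to a semialgebraic map `ℝ² → ℝ²`. -/
theorem isSemialgebraicMapOn_of_graph {O : Set ℂ} {h : ℂ → ℂ}
    (hs : IsSemialgebraic ℚ {z : Fin 4 → ℝ | cxT z ∈ O ∧ cxW z = h (cxT z)}) :
    IsSemialgebraicMapOn ℚ {x : Fin 2 → ℝ | cx x ∈ O}
      (fun x => ![(h (cx x)).re, (h (cx x)).im]) := by
  unfold IsSemialgebraicMapOn
  rw [setOf_exists_eq_append]
  convert hs using 1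
  ext z
  simp only [mem_setOf_eq]
  have h1 : cx (fun i : Fin 2 => z (Fin.castAdd 2 i)) = cxT z := rfl
  rw [h1]
  refine and_congr_right fun _ => ?_
  rw [funext_iff, Fin.forall_fin_two, Complex.ext_iff]
  exact Iff.rfl

/-- From the graph in `ℝ⁴` to semialgebraic real and imaginary parts on subsets of the plane. -/
theorem re_im_of_graph {O : Set ℂ} {h : ℂ → ℂ}
    (hO : IsSemialgebraic ℚ {x : Fin 2 → ℝ | cx x ∈ O})
    (hs : IsSemialgebraic ℚ {z : Fin 4 → ℝ | cxT z ∈ O ∧ cxW z = h (cxT z)})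
    {s : Set (Fin 2 → ℝ)} (hss : IsSemialgebraic ℚ s) (hsub : ∀ x ∈ s, cx x ∈ O) :
    IsSemialgebraicFunOn ℚ s (fun x => (h (cx x)).re) ∧
      IsSemialgebraicFunOn ℚ s (fun x => (h (cx x)).im) := by
  have hm := (isSemialgebraicMapOn_iff_forall_holds hO).1 (isSemialgebraicMapOn_of_graph hs)
  exact ⟨(by simpa using hm 0 : IsSemialgebraicFunOn ℚ {x : Fin 2 → ℝ | cx x ∈ O}
      (fun x => (h (cx x)).re)).mono hsub hss,
    (by simpa using hm 1 : IsSemialgebraicFunOn ℚ {x : Fin 2 → ℝ | cx x ∈ O}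
      (fun x => (h (cx x)).im)).mono hsub hss⟩

/-- The open disc `{x | ‖cx x‖ < R₁} ⊆ ℝ²` is `ℚ`-semialgebraic. -/
theorem isSemialgebraic_setOf_cx_mem_ball {R₁ : ℚ} (hR : 0 < R₁) :
    IsSemialgebraic ℚ {x : Fin 2 → ℝ | cx x ∈ ball (0 : ℂ) R₁} := by
  convert (isSemialgebraic_setOf_cxT_mem_ball hR).preimage_comp (![0, 1, 0, 0] : Fin 4 → Fin 2)
    using 1
  ext x
  simp only [mem_setOf_eq, mem_preimage]
  rfl

variable {R₁ : ℚ} {g : ℂ → ℂ}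

/-- **Theorem A.** The real and imaginary parts of a holomorphic function on a rational disc which
is algebraic over `ℚ(t)` are `ℚ`-semialgebraic functions on every `ℚ`-semialgebraic subset of the
disc. -/
theorem re_im_algHolo (hR : 0 < R₁) (hg : DifferentiableOn ℂ g (ball 0 R₁))
    (hP : ∃ P : MvPolynomial (Fin 2) ℚ, P ≠ 0 ∧ ∀ t ∈ ball (0 : ℂ) R₁, aeval ![g t, t] P = 0)
    {s : Set (Fin 2 → ℝ)} (hs : IsSemialgebraic ℚ s) (hsub : ∀ x ∈ s, cx x ∈ ball (0 : ℂ) R₁) :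
    IsSemialgebraicFunOn ℚ s (fun x => (g (cx x)).re) ∧
      IsSemialgebraicFunOn ℚ s (fun x => (g (cx x)).im) :=
  re_im_of_graph (isSemialgebraic_setOf_cx_mem_ball hR) (isSemialgebraic_graph hR hg hP) hs hsub

/-- **Theorem A for the derivative.** Same for `g'`. -/
theorem re_im_algHolo_deriv (hR : 0 < R₁) (hg : DifferentiableOn ℂ g (ball 0 R₁))
    (hP : ∃ P : MvPolynomial (Fin 2) ℚ, P ≠ 0 ∧ ∀ t ∈ ball (0 : ℂ) R₁, aeval ![g t, t] P = 0)
    {s : Set (Fin 2 → ℝ)} (hs : IsSemialgebraic ℚ s) (hsub : ∀ x ∈ s, cx x ∈ ball (0 : ℂ) R₁) :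
    IsSemialgebraicFunOn ℚ s (fun x => (deriv g (cx x)).re) ∧
      IsSemialgebraicFunOn ℚ s (fun x => (deriv g (cx x)).im) :=
  re_im_of_graph (isSemialgebraic_setOf_cx_mem_ball hR) (isSemialgebraic_graph_deriv hR hg hP)
    hs hsub

end Packaging

end Summit.KontsevichZagierPeriods.ComplexOrientations.CauchyMoveAux
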